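import Summits.ValiantsHypothesis.ValiantsHypothesis.Theorems.LacunarySymmetroidMatrixDescartesCensusEnvelopeSetup

/-!
# `MatrixDescartes` census — the ENVELOPE BUDGET theorem: along the roots of a hypothetical twenty the trace flips ≤ 3 times

HONEST FRAMING.  Object-search cell `pub-symmetroid`, door-A seat `val-sym-door-p1` (items stmt-ValiantsHypothesis-19979 `DoorA26`,
19980 `DoorA34`; OPEN, never asserted).  A located NECESSARY CONDITION on a hypothetical twenty, valid on EVERY support, of a
root-side kind (the cell's certificate rows are coefficient-side).  Let `F = ∑ X^(d l) • S l` be a real symmetric `2 × 2` six-term pencil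
whose determinant has `20` distinct positive roots `r 0 < ⋯ < r 19`.  By `…CensusTwentyRootStructure` each `F(r k)` is semidefinite of
rank one with a TYPE `sign tr F(r k) ≠ 0` (PSD / NSD boundary point).

**Theorem `card_traceFlips_le_three_of_twenty`: the type changes at most `3` times along `k = 0, …, 19`.**  (Trivial bound: `5`,
since `tr F` is a six-nomial.)

MECHANISM (envelope budget): every `f_u(x) = uᵀF(x)u` is a six-nomial, positive where `F ≻ 0`, negative where `F ≺ 0`; a type flip
can only happen across an INDEFINITE gap and costs every `f_u` one sign change, a flip-free indefinite inner gap costs a dip direction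
two; `≥ 9` indefinite inner gaps, `≤ 5` flips ⇒ a flip-free one exists ⇒ `#flips + 2 ≤ 5` (setup: `…CensusEnvelopeSetup`).

Nothing here bounds `ζ_sym(2,6)`, decides `DoorA26`/`DoorA34`, or bears on `MatrixDescartes` (stmt-ValiantsHypothesis-18050) / `VP ≠ VNP`.

[folklore] Envelope/budget argument (seat report DOOR-A-P1-REPORT §3); intermediate value theorem + sparse Descartes; elementary.
-/

-- the D-0017 layout repeats a namespace component (single-conjunct summit); the `dupNamespace` linter flags it; name mandated.
set_option linter.dupNamespace false

namespace Summit.ValiantsHypothesis.ValiantsHypothesis.Theorems.LacunarySymmetroidMatrixDescartes.Census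

open Polynomial Finset
open scoped BigOperators Polynomial Matrix
open Summit.ValiantsHypothesis.ValiantsHypothesis.Theorems.SymmetroidDescartes (eval_det_pencil)

/-- **ENVELOPE BUDGET — along the roots of a hypothetical twenty the trace flips at most three times** (symmetric letters, ANY
support).  Let a real symmetric `2 × 2` six-term pencil have `20` distinct positive det-roots `r 0 < ⋯ < r 19` (given as members of
`roots`, so the determinant is not the zero polynomial).  Then `tr F(r k) ≠ 0` for all `k` (`trace_pencil_eval_ne_zero_of_twenty`) and the
number of consecutive pairs with `tr F(r k) · tr F(r (k+1)) < 0` is at most `3` (trivial bound: `5`). [folklore] -/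
theorem card_traceFlips_le_three_of_twenty (d : Fin 6 → ℕ) (S : Fin 6 → Matrix (Fin 2) (Fin 2) ℝ) (hS : ∀ l, (S l).IsSymm)
    (r : Fin 20 → ℝ) (hr : StrictMono r) (hr0 : ∀ k, 0 < r k)
    (hroot : ∀ k, r k ∈ (Matrix.det (∑ l, ((X : ℝ[X]) ^ d l) • (S l).map C)).roots) :
    (Finset.univ.filter (fun k : Fin 19 =>
        ((∑ l, r k.castSucc ^ d l • S l) 0 0 + (∑ l, r k.castSucc ^ d l • S l) 1 1) *
          ((∑ l, r k.succ ^ d l • S l) 0 0 + (∑ l, r k.succ ^ d l • S l) 1 1) < 0)).card ≤ 3 := by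
  classical
  set p := Matrix.det (∑ l, ((X : ℝ[X]) ^ d l) • (S l).map C) with hp
  obtain ⟨Fl, hFl⟩ : ∃ Fl : Finset (Fin 19), Fl = Finset.univ.filter (fun k : Fin 19 =>
        ((∑ l, r k.castSucc ^ d l • S l) 0 0 + (∑ l, r k.castSucc ^ d l • S l) 1 1) *
          ((∑ l, r k.succ ^ d l • S l) 0 0 + (∑ l, r k.succ ^ d l • S l) 1 1) < 0) := ⟨_, rfl⟩
  rw [← hFl]
  -- ## opaque local functions: evaluated pencil `Fm`, trace `T`; generic facts
  obtain ⟨Fm, hFm⟩ : ∃ Fm : ℝ → Matrix (Fin 2) (Fin 2) ℝ, ∀ x, Fm x = ∑ l, x ^ d l • S l := ⟨_, fun _ => rfl⟩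
  obtain ⟨T, hT⟩ : ∃ T : ℝ → ℝ, ∀ x, T x = Fm x 0 0 + Fm x 1 1 := ⟨_, fun _ => rfl⟩
  have hFsym : ∀ x, (Fm x).IsSymm := by
    intro x
    rw [hFm]
    unfold Matrix.IsSymm
    rw [Matrix.transpose_sum]
    exact Finset.sum_congr rfl fun l _ => by rw [Matrix.transpose_smul, (hS l).eq]
  have hpev : ∀ x, p.eval x = (Fm x).det := fun x => by rw [hp, eval_det_pencil S d x, hFm]
  have hφ : ∀ (u : Fin 2 → ℝ) (x : ℝ),
      (Matrix.det (∑ l, ((X : ℝ[X]) ^ d l) • (!![u ⬝ᵥ (S l *ᵥ u)] : Matrix (Fin 1) (Fin 1) ℝ).map C)).eval x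
        = u ⬝ᵥ (Fm x *ᵥ u) := by
    intro u x
    rw [eval_det_pencil_one, hFm, quadForm_pencil_eval]
  have hdefT : ∀ x, 0 < p.eval x → ∀ u : Fin 2 → ℝ, u ≠ 0 → 0 < T x * (u ⬝ᵥ (Fm x *ᵥ u)) := by
    intro x hx u hu
    rw [hpev] at hx; rw [hT]
    exact trace_mul_quadForm_pos_of_det_pos _ (hFsym x) hx u hu
  have sgn_pos_trans : ∀ {a b c : ℝ}, 0 < a * b → 0 < b * c → 0 < a * c := fun {a} {b} {c} h1 h2 =>
    mul_pos_of_mul_neg_of_mul_neg (a := a) (b := -b) (c := c) (by rw [mul_neg]; linarith) (by rw [neg_mul]; linarith)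
  -- ## the midpoint bookkeeping (part 1 of this pair of files)
  obtain ⟨R, M, hRlt, hMpos, hMmono, hMne, halt, hRT', htransR', htransL'⟩ := twenty_midpoints d S hS r hr hr0 hroot
  have hRT : ∀ i, i < 20 → T (R i) ≠ 0 := fun i hi => by rw [hT, hFm]; exact hRT' i hi
  have htransR : ∀ j, j < 20 → 0 < p.eval (M j) → 0 < T (M j) * T (R j) := fun j hj hMj => by
    rw [hT, hT, hFm, hFm]; exact htransR' j hj hMj
  have htransL : ∀ j, 0 < j → j ≤ 20 → 0 < p.eval (M j) → 0 < T (R (j - 1)) * T (M j) := fun j hj1 hj20 hMj => by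
    rw [hT, hT, hFm, hFm]; exact htransL' j hj1 hj20 hMj
  have hMle : ∀ i j, i ≤ j → M i ≤ M j := fun i j hij =>
    (eq_or_lt_of_le hij).elim (fun h => by rw [h]) (fun h => (hMmono i j h).le)
  -- ## membership in the flip set, in terms of `T` and `R`
  have hRc : ∀ k : Fin 19, R k.val = r k.castSucc := fun k => by rw [hRlt k.val (by omega)]; rfl
  have hRs : ∀ k : Fin 19, R (k.val + 1) = r k.succ := fun k => by rw [hRlt (k.val + 1) (by omega)]; rfl
  have hFlmem : ∀ k : Fin 19, k ∈ Fl ↔ T (R k.val) * T (R (k.val + 1)) < 0 := by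
    intro k
    rw [hRc, hRs, hFl, Finset.mem_filter, hT, hT, hFm, hFm]
    simp only [Finset.mem_univ, true_and]
  -- a flip at `k` forces the gap midpoint `M (k+1)` to be an indefinite point
  have hflip_indef : ∀ k : Fin 19, k ∈ Fl → p.eval (M (k.val + 1)) < 0 := by
    intro k hk
    rw [hFlmem] at hk
    by_contra hge
    have hpos : 0 < p.eval (M (k.val + 1)) := lt_of_le_of_ne (not_lt.mp hge) (hMne _).symm
    have h1 := htransR (k.val + 1) (by omega) hpos        -- T(M(k+1)) T(R(k+1)) > 0
    have h2 := htransL (k.val + 1) (by omega) (by omega) hpos   -- T(R k) T(M(k+1)) > 0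
    simp only [Nat.add_sub_cancel] at h2
    have h3 := sgn_pos_trans h2 h1                               -- T(R k) T(R(k+1)) > 0
    exact absurd hk (not_lt.mpr h3.le)
  -- neighbours of an indefinite inner midpoint are definite
  have hnbr : ∀ i, 0 < i → i < 20 → p.eval (M i) < 0 → 0 < p.eval (M (i - 1)) ∧ 0 < p.eval (M (i + 1)) := by
    intro i hi1 hi19 hneg
    have a1 := halt i hi1 (by omega)
    have a2 := halt (i + 1) (by omega) (by omega)
    simp only [Nat.add_sub_cancel] at a2
    constructor
    · exact sgn_pos_of_mul_neg_of_neg a1 hneg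
    · rw [mul_comm] at a2
      exact sgn_pos_of_mul_neg_of_neg a2 hneg
  -- for a flip `k`: the quadratic forms change sign between the definite midpoints `M k` and `M (k+2)`
  have hflip_sign : ∀ k : Fin 19, k ∈ Fl → T (M k.val) * T (M (k.val + 2)) < 0 := by
    intro k hk
    have hind := hflip_indef k hk
    rw [hFlmem] at hk
    obtain ⟨hL, hR'⟩ := hnbr (k.val + 1) (by omega) (by omega) hind
    simp only [Nat.add_sub_cancel] at hL
    have h1 := htransR k.val (by omega) hL            -- T(M k) T(R k) > 0
    have h2 := htransL (k.val + 2) (by omega) (by omega) hR'   -- T(R(k+1)) T(M(k+2)) > 0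
    simp only [show k.val + 2 - 1 = k.val + 1 by omega] at h2
    exact mul_neg_of_mul_neg_of_mul_pos (mul_neg_of_mul_pos_of_mul_neg h1 hk) h2
  -- ## the counting step: separated sign changes of one quadratic form
  -- the flip intervals `(M k, M (k+2))`, as a separated family, for ANY non-zero direction
  have hflipfam : ∀ u : Fin 2 → ℝ, u ≠ 0 →
      (∀ q ∈ Fl.image (fun k : Fin 19 => (M k.val, M (k.val + 2))),
        0 < q.1 ∧ q.1 < q.2 ∧
          (Matrix.det (∑ l, ((X : ℝ[X]) ^ d l) • (!![u ⬝ᵥ (S l *ᵥ u)] : Matrix (Fin 1) (Fin 1) ℝ).map C)).eval q.1 *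
          (Matrix.det (∑ l, ((X : ℝ[X]) ^ d l) • (!![u ⬝ᵥ (S l *ᵥ u)] : Matrix (Fin 1) (Fin 1) ℝ).map C)).eval q.2 < 0) := by
    intro u hu q hq
    obtain ⟨k, hk, rfl⟩ := Finset.mem_image.mp hq
    refine ⟨hMpos k.val, hMmono k.val (k.val + 2) (by omega), ?_⟩
    dsimp only
    rw [hφ, hφ]
    have hind := hflip_indef k hk
    obtain ⟨hL, hR'⟩ := hnbr (k.val + 1) (by omega) (by omega) hind
    simp only [Nat.add_sub_cancel] at hL
    have s1 := hdefT _ hL u hu           -- T(Mk) φ(Mk) > 0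
    have s2 := hdefT _ hR' u hu          -- T(Mk+2) φ(Mk+2) > 0
    have s3 := hflip_sign k hk           -- T(Mk) T(Mk+2) < 0
    -- φ(Mk) T(Mk) > 0, T(Mk) T(Mk+2) < 0 ⇒ φ(Mk) T(Mk+2) < 0 ; with T(Mk+2) φ(Mk+2) > 0 ⇒ φ(Mk) φ(Mk+2) < 0
    have s1' : 0 < (u ⬝ᵥ (Fm (M k.val) *ᵥ u)) * T (M k.val) := by rw [mul_comm]; exact s1
    exact mul_neg_of_mul_neg_of_mul_pos (mul_neg_of_mul_pos_of_mul_neg s1' s3) s2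
  have hflipsep : ∀ q ∈ Fl.image (fun k : Fin 19 => (M k.val, M (k.val + 2))),
      ∀ q' ∈ Fl.image (fun k : Fin 19 => (M k.val, M (k.val + 2))), q ≠ q' → q.2 ≤ q'.1 ∨ q'.2 ≤ q.1 := by
    intro q hq q' hq' hne
    obtain ⟨k, hk, rfl⟩ := Finset.mem_image.mp hq
    obtain ⟨k', hk', rfl⟩ := Finset.mem_image.mp hq'
    have hkk : k.val ≠ k'.val := fun h => hne (by rw [Fin.ext h])
    -- both `M (k+1)` and `M (k'+1)` are indefinite; indefinite midpoints are never adjacent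
    have i1 := hflip_indef k hk
    have i2 := hflip_indef k' hk'
    have hfar : k.val + 2 ≤ k'.val ∨ k'.val + 2 ≤ k.val := by
      by_contra hcon
      simp only [not_or, not_le] at hcon
      rcases Nat.lt_or_gt_of_ne hkk with hlt | hlt
      · have : k'.val = k.val + 1 := by omega
        have a := halt (k.val + 2) (by omega) (by omega)
        simp only [show k.val + 2 - 1 = k.val + 1 by omega] at a
        rw [this] at i2
        exact not_mul_neg_of_neg_of_neg a i1 i2
      · have : k.val = k'.val + 1 := by omega
        have a := halt (k'.val + 2) (by omega) (by omega)
        simp only [show k'.val + 2 - 1 = k'.val + 1 by omega] at a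
        rw [this] at i1
        exact not_mul_neg_of_neg_of_neg a i2 i1
    rcases hfar with h | h
    · left
      show M (k.val + 2) ≤ M k'.val
      exact hMle _ _ h
    · right
      show M (k'.val + 2) ≤ M k.val
      exact hMle _ _ h
  have hcardfam : (Fl.image (fun k : Fin 19 => (M k.val, M (k.val + 2)))).card = Fl.card := by
    apply Finset.card_image_of_injOn
    intro k _ k' _ h
    have h1 : M k.val = M k'.val := congrArg Prod.fst h
    by_contra hne
    have hkk : k.val ≠ k'.val := fun h' => hne (Fin.ext h')
    rcases Nat.lt_or_gt_of_ne hkk with hlt | hlt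
    · exact absurd h1 (ne_of_lt (hMmono _ _ hlt))
    · exact absurd h1 (ne_of_gt (hMmono _ _ hlt))
  -- ## step 1: flips ≤ 5, with any direction whose form is not the zero six-nomial
  obtain ⟨u₀, hu₀⟩ : ∃ u₀ : Fin 2 → ℝ, u₀ ⬝ᵥ (Fm (M 0) *ᵥ u₀) ≠ 0 := by
    rcases lt_or_gt_of_ne (hMne 0) with hneg | hpos
    · rw [hpev] at hneg
      obtain ⟨u, hu⟩ := exists_quadForm_neg_of_det_neg _ (hFsym _) hneg
      exact ⟨u, ne_of_lt hu⟩
    · refine ⟨![1, 0], ?_⟩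
      have := hdefT (M 0) hpos ![1, 0] (by intro h; have := congrFun h 0; simp at this)
      intro h0; rw [h0, mul_zero] at this; exact lt_irrefl _ this
  have hu₀ne : u₀ ≠ 0 := by
    intro h; apply hu₀; rw [h]; simp
  have hFl5 : Fl.card ≤ 5 := by
    obtain ⟨φ₀, hφ₀⟩ : ∃ φ₀ : ℝ[X],
        φ₀ = Matrix.det (∑ l, ((X : ℝ[X]) ^ d l) • (!![u₀ ⬝ᵥ (S l *ᵥ u₀)] : Matrix (Fin 1) (Fin 1) ℝ).map C) :=
      ⟨_, rfl⟩
    have hne' : Matrix.det (∑ l, ((X : ℝ[X]) ^ d l) • (!![u₀ ⬝ᵥ (S l *ᵥ u₀)] : Matrix (Fin 1) (Fin 1) ℝ).map C) ≠ 0 := by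
      intro h0
      apply hu₀
      rw [← hφ u₀ (M 0), h0, eval_zero]
    have hfam := hflipfam u₀ hu₀ne
    rw [← hφ₀] at hfam
    have h1 := card_le_card_posRoots_of_signChanges φ₀ _ hfam hflipsep
    rw [hcardfam] at h1
    have h2 := card_posRoots_nomial_lt d (fun l => u₀ ⬝ᵥ (S l *ᵥ u₀)) hne'
    rw [← hφ₀] at h2
    omega
  -- ## step 2: an indefinite inner gap WITHOUT flip exists (there are ≥ 9 indefinite inner gaps)
  obtain ⟨Ind, hInd⟩ : ∃ Ind : Finset ℕ, Ind = (Finset.Icc 1 19).filter (fun i => p.eval (M i) < 0) := ⟨_, rfl⟩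
  have hInd9 : 9 ≤ Ind.card := by
    let g : ℕ → ℕ := fun t => if p.eval (M (2 * t + 1)) < 0 then 2 * t + 1 else 2 * t + 2
    have hgmem : ∀ t ∈ Finset.range 9, g t ∈ Ind := by
      intro t ht
      rw [Finset.mem_range] at ht
      simp only [g]
      split_ifs with h
      · rw [hInd]; exact Finset.mem_filter.mpr ⟨Finset.mem_Icc.mpr ⟨by omega, by omega⟩, h⟩
      · rw [hInd]; refine Finset.mem_filter.mpr ⟨Finset.mem_Icc.mpr ⟨by omega, by omega⟩, ?_⟩
        have a := halt (2 * t + 2) (by omega) (by omega)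
        simp only [show 2 * t + 2 - 1 = 2 * t + 1 by omega] at a
        have hpos : 0 < p.eval (M (2 * t + 1)) := lt_of_le_of_ne (not_lt.mp h) (hMne _).symm
        exact sgn_neg_of_mul_neg_of_pos a hpos
    have hginj : Set.InjOn g (Finset.range 9) := by
      intro t _ t' _ h
      have k1 : (g t - 1) / 2 = t := by simp only [g]; split_ifs <;> omega
      have k2 : (g t' - 1) / 2 = t' := by simp only [g]; split_ifs <;> omega
      rw [← k1, ← k2, h]
    have := Finset.card_le_card_of_injOn g hgmem hginj
    simpa using this
  obtain ⟨FlN, hFlN⟩ : ∃ FlN : Finset ℕ, FlN = Fl.image (fun k : Fin 19 => k.val + 1) := ⟨_, rfl⟩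
  have hFlN5 : FlN.card ≤ 5 := by rw [hFlN]; exact (Finset.card_image_le).trans hFl5
  obtain ⟨i₀, hi₀Ind, hi₀not⟩ : ∃ i₀ ∈ Ind, i₀ ∉ FlN := by
    have : ¬ Ind ⊆ FlN := fun h => by have := Finset.card_le_card h; omega
    exact Finset.not_subset.mp this
  rw [hInd, Finset.mem_filter, Finset.mem_Icc] at hi₀Ind
  obtain ⟨⟨hi₀1, hi₀19⟩, hi₀neg⟩ := hi₀Ind
  have hnoflip : 0 < T (R (i₀ - 1)) * T (R i₀) := by
    rcases lt_trichotomy (T (R (i₀ - 1)) * T (R i₀)) 0 with hlt | heq | hgt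
    · exfalso
      apply hi₀not
      rw [hFlN, Finset.mem_image]
      refine ⟨⟨i₀ - 1, by omega⟩, ?_, by simp only; omega⟩
      rw [hFlmem]
      simp only [show i₀ - 1 + 1 = i₀ by omega]
      exact hlt
    · exfalso
      rcases mul_eq_zero.mp heq with h | h
      · exact hRT (i₀ - 1) (by omega) h
      · exact hRT i₀ (by omega) h
    · exact hgt
  obtain ⟨hL0, hR0⟩ := hnbr i₀ hi₀1 (by omega) hi₀neg
  have hTT : 0 < T (M (i₀ - 1)) * T (M (i₀ + 1)) := by
    have h1 := htransR (i₀ - 1) (by omega) hL0        -- T(M(i₀-1)) T(R(i₀-1)) > 0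
    have h2 := htransL (i₀ + 1) (by omega) (by omega) hR0   -- T(R i₀) T(M(i₀+1)) > 0
    simp only [Nat.add_sub_cancel] at h2
    exact sgn_pos_trans (sgn_pos_trans h1 hnoflip) h2
  -- the dip direction
  obtain ⟨u, hu⟩ : ∃ u : Fin 2 → ℝ, T (M (i₀ - 1)) * (u ⬝ᵥ (Fm (M i₀) *ᵥ u)) < 0 := by
    have hdet : (Fm (M i₀)).det < 0 := by rw [← hpev]; exact hi₀neg
    rcases lt_or_gt_of_ne (show T (M (i₀ - 1)) ≠ 0 from fun h => by rw [h, zero_mul] at hTT; exact lt_irrefl _ hTT) with hneg | hpos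
    · obtain ⟨u, hu⟩ := exists_quadForm_pos_of_det_neg _ (hFsym _) hdet
      exact ⟨u, mul_neg_of_neg_of_pos hneg hu⟩
    · obtain ⟨u, hu⟩ := exists_quadForm_neg_of_det_neg _ (hFsym _) hdet
      exact ⟨u, mul_neg_of_pos_of_neg hpos hu⟩
  have hune : u ≠ 0 := by
    intro h; rw [h] at hu; simp at hu
  obtain ⟨φ, hφdef⟩ : ∃ φ : ℝ[X],
      φ = Matrix.det (∑ l, ((X : ℝ[X]) ^ d l) • (!![u ⬝ᵥ (S l *ᵥ u)] : Matrix (Fin 1) (Fin 1) ℝ).map C) := ⟨_, rfl⟩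
  have hφev : ∀ x, φ.eval x = u ⬝ᵥ (Fm x *ᵥ u) := fun x => by rw [hφdef, hφ]
  have hφne' : Matrix.det (∑ l, ((X : ℝ[X]) ^ d l) • (!![u ⬝ᵥ (S l *ᵥ u)] : Matrix (Fin 1) (Fin 1) ℝ).map C) ≠ 0 := by
    intro h0
    have : u ⬝ᵥ (Fm (M i₀) *ᵥ u) = 0 := by rw [← hφev, hφdef, h0, eval_zero]
    rw [this, mul_zero] at hu; exact lt_irrefl _ hu
  -- the two dip intervals
  have hdip1 : φ.eval (M (i₀ - 1)) * φ.eval (M i₀) < 0 := by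
    rw [hφev, hφev]
    have s1 := hdefT _ hL0 u hune        -- T(M(i₀-1)) φ(M(i₀-1)) > 0
    have s1' : 0 < (u ⬝ᵥ (Fm (M (i₀ - 1)) *ᵥ u)) * T (M (i₀ - 1)) := by rw [mul_comm]; exact s1
    exact mul_neg_of_mul_pos_of_mul_neg s1' hu
  have hdip2 : φ.eval (M i₀) * φ.eval (M (i₀ + 1)) < 0 := by
    rw [hφev, hφev]
    have s2 := hdefT _ hR0 u hune        -- T(M(i₀+1)) φ(M(i₀+1)) > 0
    -- φ(M i₀) T(M(i₀-1)) < 0, T(M(i₀-1)) T(M(i₀+1)) > 0 ⇒ φ(M i₀) T(M(i₀+1)) < 0 ; then with s2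
    have hu' : (u ⬝ᵥ (Fm (M i₀) *ᵥ u)) * T (M (i₀ - 1)) < 0 := by rw [mul_comm]; exact hu
    exact mul_neg_of_mul_neg_of_mul_pos (mul_neg_of_mul_neg_of_mul_pos hu' hTT) s2
  -- the full family: flips ∪ two dips
  obtain ⟨Iflip, hIflip⟩ : ∃ Iflip : Finset (ℝ × ℝ), Iflip = Fl.image (fun k : Fin 19 => (M k.val, M (k.val + 2))) := ⟨_, rfl⟩
  obtain ⟨I, hI⟩ : ∃ I : Finset (ℝ × ℝ), I = Iflip ∪ {(M (i₀ - 1), M i₀), (M i₀, M (i₀ + 1))} := ⟨_, rfl⟩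
  have hdipne : (M (i₀ - 1), M i₀) ≠ (M i₀, M (i₀ + 1)) := by
    intro h; have := congrArg Prod.fst h; exact absurd this (ne_of_lt (hMmono _ _ (by omega)))
  have hdip_notin : ∀ q ∈ ({(M (i₀ - 1), M i₀), (M i₀, M (i₀ + 1))} : Finset (ℝ × ℝ)), q ∉ Iflip := by
    intro q hq hqI
    rw [hIflip] at hqI
    obtain ⟨k, hk, hkq⟩ := Finset.mem_image.mp hqI
    simp only [Finset.mem_insert, Finset.mem_singleton] at hq
    rcases hq with rfl | rfl
    · have h1 : M k.val = M (i₀ - 1) := congrArg Prod.fst hkq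
      have h2 : M (k.val + 2) = M i₀ := congrArg Prod.snd hkq
      have e1 : k.val = i₀ - 1 := by
        by_contra hne; rcases Nat.lt_or_gt_of_ne hne with h | h
        · exact absurd h1 (ne_of_lt (hMmono _ _ h))
        · exact absurd h1 (ne_of_gt (hMmono _ _ h))
      have e2 : k.val + 2 = i₀ := by
        by_contra hne; rcases Nat.lt_or_gt_of_ne hne with h | h
        · exact absurd h2 (ne_of_lt (hMmono _ _ h))
        · exact absurd h2 (ne_of_gt (hMmono _ _ h))
      omega
    · have h1 : M k.val = M i₀ := congrArg Prod.fst hkq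
      have h2 : M (k.val + 2) = M (i₀ + 1) := congrArg Prod.snd hkq
      have e1 : k.val = i₀ := by
        by_contra hne; rcases Nat.lt_or_gt_of_ne hne with h | h
        · exact absurd h1 (ne_of_lt (hMmono _ _ h))
        · exact absurd h1 (ne_of_gt (hMmono _ _ h))
      have e2 : k.val + 2 = i₀ + 1 := by
        by_contra hne; rcases Nat.lt_or_gt_of_ne hne with h | h
        · exact absurd h2 (ne_of_lt (hMmono _ _ h))
        · exact absurd h2 (ne_of_gt (hMmono _ _ h))
      omega
  have hIcard : I.card = Fl.card + 2 := by
    rw [hI, Finset.card_union_of_disjoint, hIflip, hcardfam, Finset.card_pair hdipne]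
    rw [Finset.disjoint_right]
    exact hdip_notin
  have hIsign : ∀ q ∈ I, 0 < q.1 ∧ q.1 < q.2 ∧ φ.eval q.1 * φ.eval q.2 < 0 := by
    intro q hq
    rw [hI, Finset.mem_union, hIflip] at hq
    rcases hq with hq | hq
    · have := hflipfam u hune q hq
      rw [← hφdef] at this
      exact this
    · simp only [Finset.mem_insert, Finset.mem_singleton] at hq
      rcases hq with rfl | rfl
      · exact ⟨hMpos (i₀ - 1), hMmono (i₀ - 1) i₀ (by omega), hdip1⟩
      · exact ⟨hMpos i₀, hMmono i₀ (i₀ + 1) (by omega), hdip2⟩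
  -- separation: a flip interval `(M k, M (k+2))` (with `M (k+1)` indefinite, `k+1 ≠ i₀`) vs the dip intervals around `i₀`
  have hflipdip : ∀ k : Fin 19, k ∈ Fl → k.val + 3 ≤ i₀ ∨ i₀ + 1 ≤ k.val := by
    intro k hk
    have hind := hflip_indef k hk
    have hne : k.val + 1 ≠ i₀ := by
      intro h; apply hi₀not; rw [hFlN, Finset.mem_image]; exact ⟨k, hk, h⟩
    by_contra hcon
    simp only [not_or, not_le] at hcon
    -- then `k + 1` and `i₀` are adjacent indefinite midpoints: contradiction with alternation
    rcases Nat.lt_or_gt_of_ne hne with hlt | hlt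
    · have : i₀ = k.val + 2 := by omega
      have a := halt (k.val + 2) (by omega) (by omega)
      simp only [show k.val + 2 - 1 = k.val + 1 by omega] at a
      rw [this] at hi₀neg
      exact not_mul_neg_of_neg_of_neg a hind hi₀neg
    · have : k.val = i₀ := by omega
      have a := halt (i₀ + 1) (by omega) (by omega)
      simp only [Nat.add_sub_cancel] at a
      rw [this] at hind
      exact not_mul_neg_of_neg_of_neg a hi₀neg hind
  have hIsep : ∀ q ∈ I, ∀ q' ∈ I, q ≠ q' → q.2 ≤ q'.1 ∨ q'.2 ≤ q.1 := by
    intro q hq q' hq' hne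
    rw [hI, Finset.mem_union, hIflip] at hq hq'
    rcases hq with hq | hq <;> rcases hq' with hq' | hq'
    · exact hflipsep q hq q' hq' hne
    · obtain ⟨k, hk, rfl⟩ := Finset.mem_image.mp hq
      simp only [Finset.mem_insert, Finset.mem_singleton] at hq'
      rcases hflipdip k hk with h | h
      · left
        rcases hq' with rfl | rfl
        · show M (k.val + 2) ≤ M (i₀ - 1)
          exact hMle _ _ (by omega)
        · show M (k.val + 2) ≤ M i₀
          exact hMle _ _ (by omega)
      · right
        rcases hq' with rfl | rfl
        · show M i₀ ≤ M k.val
          exact hMle _ _ (by omega)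
        · show M (i₀ + 1) ≤ M k.val
          exact hMle _ _ (by omega)
    · obtain ⟨k, hk, rfl⟩ := Finset.mem_image.mp hq'
      simp only [Finset.mem_insert, Finset.mem_singleton] at hq
      rcases hflipdip k hk with h | h
      · right
        rcases hq with rfl | rfl
        · show M (k.val + 2) ≤ M (i₀ - 1)
          exact hMle _ _ (by omega)
        · show M (k.val + 2) ≤ M i₀
          exact hMle _ _ (by omega)
      · left
        rcases hq with rfl | rfl
        · show M i₀ ≤ M k.val
          exact hMle _ _ (by omega)
        · show M (i₀ + 1) ≤ M k.val
          exact hMle _ _ (by omega)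
    · simp only [Finset.mem_insert, Finset.mem_singleton] at hq hq'
      rcases hq with rfl | rfl <;> rcases hq' with rfl | rfl
      · exact absurd rfl hne
      · left; exact le_refl _
      · right; exact le_refl _
      · exact absurd rfl hne
  -- ## conclusion
  have h1 := card_le_card_posRoots_of_signChanges φ I hIsign hIsep
  have h2 := card_posRoots_nomial_lt d (fun l => u ⬝ᵥ (S l *ᵥ u)) hφne'
  rw [← hφdef] at h2
  rw [hIcard] at h1
  omega


end Summit.ValiantsHypothesis.ValiantsHypothesis.Theorems.LacunarySymmetroidMatrixDescartes.Census
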